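/-
Copyright (c) 2026 the pub-hodgecm-mathlib formalisation cell (harness21).  Prover seat hodgecm-mathlib-K2E4-p14 (g9), Track B ∕ K2-LIT, h413 = `stmt-HodgeConjecture-24833`,
line `K2_E1_TraceFormulaBeta`, campaign 5Res ∕ 12R3 (ROADCARD §3′ M2 v2), deal (242) of the dealer K2E1-plan (g7): THE GLUE between D5′'s per-`W` conclusion («no line mass») and the
ATOMS of ★∕📤 `K2E1ResidualLevelFiniteOfAtomsU.levelFinite_of_atoms` (this seat, (237)) — abstract linear algebra, then the `𝒢`-print.
-/
import Summits.HodgeConjecture.HodgeConjecture.Theorems.K2E1CuspidalSpectrumUnitaryDefs   -- ★ `residualSubspace` (for the `𝒢`-print only)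
import Mathlib.LinearAlgebra.FiniteDimensional.Lemmas
import Mathlib.LinearAlgebra.Pi
import HarnessLib

/-!
# K2·E1 — `K2E1ResidueAtomsOfNoLineMassU`: NO LINE MASS + EXHAUSTION ⟹ ATOMS (the glue between D5′ and the top assembly of the D-road; abstract, then the `𝒢`-print)

Track B ∕ K2-LIT, crux h413 = `stmt-HodgeConjecture-24833`, route of record `HCCMUnconditional`; cell `hodgecm-mathlib`, squad K2, ENGINE E1 (campaign 5Res ∕ 12R3, ROADCARD §3′ M2 v2).
THEOREMS ONLY (no `def`, no `instance`, no notation, no named-fact hypothesis, no `sorry`); lane `--supports stmt-HodgeConjecture-24833 --as helper` (count-neutral).  Closes no socket.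

THE ARGUMENT (dealer (242)).  Fix a `K`-type∕level `(χ, U)` and let `Eis ≤ H` be the `(χ,U)`-part of `(L²_cusp)ᗮ` (any submodule here).  The spectral-measure exhaustion (F3∕C7) gives
FINITELY many families `b` with linear coordinate maps `U_b : H →ₗ[ℂ] A_b × L_b` — `A_b` the finite-dimensional space of ATOMS (residue lines) of the family, `L_b` its LINE space (the
continuous spectrum on the unitary axis) — jointly injective on `Eis` (EXH).  D5′ (★ p860349, per irreducible `W ≤ L²_res`): the line components of `P w` vanish, `snd (U_b (P w)) = 0`
for every `b` («no line mass»), and `P w ∈ Eis`.  THEN `A := Eis ⊓ ⨅_b ker (snd ∘ U_b)` is finite-dimensional — `x ↦ (fst (U_b x))_b` embeds it into `Π_b A_b` by (EXH) — and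
contains every `P w`: this is the ATOM clause of `levelFinite_of_atoms` at `(χ, U)`.
* §1 `finiteDimensional_inf_iInf_ker_snd` — ABSTRACT: (EXH) ⟹ `Eis ⊓ ⨅_b ker (snd ∘ U_b)` is finite-dimensional (any `ℂ`-module, `b` over a `Finite` type).
* §2 `exists_atom_of_noLineMass` — ABSTRACT: (EXH) + «`P w ∈ Eis`, `snd (U_b (P w)) = 0`» over a family of submodules ⟹ `∃ A` finite-dimensional containing every `P w`.
* §3 `𝒢`-PRINT **`hatoms_of_noLineMass`** — for `𝒢 : AdelicGroupData F`, `μ`, `𝔓` and one `(χ, U)`: the projector letters (`P` continuous linear, the identity on the `(χ,U)`-eigenvectors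
  of `R ∘ ιK`) + `Eis, U_b` with (EXH) + D5′'s «no line mass» over the irreducible closed `W ≤ residualSubspace 𝒢 μ 𝔓` ⟹ the `(χ, U)`-instance of the `hatoms` binder of
  `levelFinite_of_atoms` VERBATIM (`∃ P A, FiniteDimensional A ∧ (fixing) ∧ ∀ W irreducible ≤ L²_res, ∀ w ∈ W, P w ∈ A`).
HONEST LABEL: HC_CM is proved only modulo the 7 printed citations (2 remaining named inputs: hLiu418 = `stmt-HodgeConjecture-24832`, h413 = `stmt-HodgeConjecture-24833`) until rung 0
closes; this file asserts no named fact and closes no socket; count-neutral; the `𝒢`-print is CONDITIONAL on (EXH) (F3∕C7 head), the projector letters ((S2c)) and D5′'s «no line mass».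

## References
* [MoeglinWaldspurger1995] C. Mœglin, J.-L. Waldspurger, *Spectral decomposition and Eisenstein series* (1995), I.2.18, V.3.13.
* [BorelJacquet1979] A. Borel, H. Jacquet, *Automorphic forms and automorphic representations*, Corvallis I (1979), §4.6.
-/

set_option autoImplicit false
-- the mandated namespace repeats the single-problem summit's segment (`HodgeConjecture.HodgeConjecture`)
set_option linter.dupNamespace false

noncomputable section

open MeasureTheory Set
open Literature.NumberTheory.Automorphic ContRepresentation
open Summit.HodgeConjecture.HodgeConjecture.Cruxes.H413.K2E1CuspidalSpectrumUnitary

namespace Summit.HodgeConjecture.HodgeConjecture.Cruxes.H413.K2E1ResidueAtomsOfNoLineMassU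

universe u

/-! ## §1 Exhaustion by finitely many families: the no-line-mass part of `Eis` embeds in `Π_b A_b` -/

section Abstract

variable {H : Type*} [AddCommGroup H] [Module ℂ H]
variable {β : Type*} [Finite β] {A L : β → Type*} [∀ b, AddCommGroup (A b)] [∀ b, Module ℂ (A b)] [∀ b, FiniteDimensional ℂ (A b)]
  [∀ b, AddCommGroup (L b)] [∀ b, Module ℂ (L b)]

/-- **(EXH) ⟹ THE NO-LINE-MASS PART OF `Eis` IS FINITE-DIMENSIONAL**: for finitely many linear `U_b : H →ₗ A_b × L_b` with `A_b` finite-dimensional, jointly injective on `Eis`,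
the submodule `Eis ⊓ ⨅_b ker (snd ∘ U_b)` embeds into `Π_b A_b` by `x ↦ (fst (U_b x))_b`, hence is finite-dimensional. [cite: MoeglinWaldspurger1995, V.3.13] -/
theorem finiteDimensional_inf_iInf_ker_snd (Eis : Submodule ℂ H) (U : ∀ b, H →ₗ[ℂ] (A b × L b))
    (hEXH : ∀ x ∈ Eis, (∀ b, U b x = 0) → x = 0) :
    FiniteDimensional ℂ ↥(Eis ⊓ ⨅ b, LinearMap.ker ((LinearMap.snd ℂ (A b) (L b)) ∘ₗ U b)) := by
  set M : Submodule ℂ H := Eis ⊓ ⨅ b, LinearMap.ker ((LinearMap.snd ℂ (A b) (L b)) ∘ₗ U b) with hM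
  let Φ : M →ₗ[ℂ] (∀ b, A b) := LinearMap.pi fun b => (LinearMap.fst ℂ (A b) (L b)) ∘ₗ U b ∘ₗ M.subtype
  refine FiniteDimensional.of_injective Φ ((injective_iff_map_eq_zero Φ).2 fun x hx => ?_)
  have hx1 : ∀ b, (U b (x : H)).1 = 0 := fun b => congrFun hx b
  have hx2 : ∀ b, (U b (x : H)).2 = 0 := fun b => by
    have h := (Submodule.mem_iInf _).1 (Submodule.mem_inf.1 x.2).2 b
    rwa [LinearMap.mem_ker] at h
  have hxU : ∀ b, U b (x : H) = 0 := fun b => Prod.ext (hx1 b) (hx2 b)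
  exact Subtype.ext (hEXH _ (Submodule.mem_inf.1 x.2).1 hxU)

/-- **(EXH) + NO LINE MASS ⟹ AN ATOM**: if moreover `P w ∈ Eis` and `snd (U_b (P w)) = 0` for every `b` and every `w` in each member `f i` (`i ∈ S`) of a family of submodules, then
`∃ A` finite-dimensional with `P w ∈ A` for all those `w` — namely `A := Eis ⊓ ⨅_b ker (snd ∘ U_b)`. [cite: MoeglinWaldspurger1995, V.3.13] -/
theorem exists_atom_of_noLineMass (Eis : Submodule ℂ H) (U : ∀ b, H →ₗ[ℂ] (A b × L b))
    (hEXH : ∀ x ∈ Eis, (∀ b, U b x = 0) → x = 0) {ι : Type*} (S : Set ι) (f : ι → Submodule ℂ H) (P : H → H)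
    (hPEis : ∀ i ∈ S, ∀ w ∈ f i, P w ∈ Eis) (hD5 : ∀ i ∈ S, ∀ w ∈ f i, ∀ b, (U b (P w)).2 = 0) :
    ∃ Aχ : Submodule ℂ H, FiniteDimensional ℂ Aχ ∧ ∀ i ∈ S, ∀ w ∈ f i, P w ∈ Aχ :=
  ⟨Eis ⊓ ⨅ b, LinearMap.ker ((LinearMap.snd ℂ (A b) (L b)) ∘ₗ U b), finiteDimensional_inf_iInf_ker_snd Eis U hEXH,
    fun i hi w hw => Submodule.mem_inf.2 ⟨hPEis i hi w hw, (Submodule.mem_iInf _).2 fun b => by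
      rw [LinearMap.mem_ker, LinearMap.comp_apply, LinearMap.snd_apply]
      exact hD5 i hi w hw b⟩⟩

end Abstract

/-! ## §3 The `𝒢`-print: the `(χ, U)`-instance of the ATOMS of `levelFinite_of_atoms` -/

section Residual

variable {F : Type} [Field F] [NumberField F] (𝒢 : AdelicGroupData.{u} F) (μ : Measure 𝒢.automorphicQuotient) [𝒢.IsAutomorphicMeasure μ]
  (𝔓 : 𝒢.ParabolicUnipotentData)
variable {β : Type*} [Finite β] {A L : β → Type*} [∀ b, AddCommGroup (A b)] [∀ b, Module ℂ (A b)] [∀ b, FiniteDimensional ℂ (A b)]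
  [∀ b, AddCommGroup (L b)] [∀ b, Module ℂ (L b)]

/-- **NO LINE MASS + EXHAUSTION ⟹ THE ATOM AT `(χ, U)`** (dealer (242); generic `𝒢`).  Data at one `K`-type∕level `(χ, U)` (`ιK : K →* G(𝔸)`, `ιa : T →* K`, `ιf : K_f →* K`): the
projector letters — `P : L² →L[ℂ] L²` the identity on every `x` with `R(ιK ιf u) x = x` (`u ∈ U`) and `R(ιK ιa t) x = χ t • x` ((S2c)); the `(χ,U)`-part `Eis ≤ L²` of `(L²_cusp)ᗮ` with
FINITELY many family coordinates `U_b : L² →ₗ[ℂ] A_b × L_b` (`A_b` finite-dimensional atoms, `L_b` lines), jointly injective on `Eis` (EXH, the F3∕C7 head); and D5′ (★ p860349) per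
irreducible closed `W ≤ L²_res`: `P w ∈ Eis` and `snd (U_b (P w)) = 0` for all `b`, `w ∈ W`.  CONCLUSION: the `(χ, U)`-instance of the `hatoms` binder of `levelFinite_of_atoms` VERBATIM.
[cite: MoeglinWaldspurger1995, I.2.18 and V.3.13] [cite: BorelJacquet1979, §4.6] -/
theorem hatoms_of_noLineMass
    {K : Type*} [Group K] (ιK : K →* 𝒢.Adelic) {T : Type*} [Group T] (ιa : T →* K) {Kf : Type*} [Group Kf] [TopologicalSpace Kf] (ιf : Kf →* K)
    (χ : T →* ℂ) (U₀ : OpenSubgroup Kf)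
    (P : 𝒢.L2 μ →L[ℂ] 𝒢.L2 μ)
    (hPfix : ∀ x : 𝒢.L2 μ, (∀ u ∈ U₀, 𝒢.rightRegular μ (ιK (ιf u)) x = x) → (∀ t : T, 𝒢.rightRegular μ (ιK (ιa t)) x = χ t • x) → P x = x)
    (Eis : Submodule ℂ (𝒢.L2 μ)) (U : ∀ b, 𝒢.L2 μ →ₗ[ℂ] (A b × L b)) (hEXH : ∀ x ∈ Eis, (∀ b, U b x = 0) → x = 0)
    (hPEis : ∀ W : ClosedSubrep (𝒢.rightRegular μ), W.toContRep.IsTopIrreducible → W ≤ residualSubspace 𝒢 μ 𝔓 → ∀ w ∈ W, P w ∈ Eis)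
    (hD5 : ∀ W : ClosedSubrep (𝒢.rightRegular μ), W.toContRep.IsTopIrreducible → W ≤ residualSubspace 𝒢 μ 𝔓 → ∀ w ∈ W, ∀ b, (U b (P w)).2 = 0) :
    ∃ (P : 𝒢.L2 μ →L[ℂ] 𝒢.L2 μ) (A : Submodule ℂ (𝒢.L2 μ)), FiniteDimensional ℂ A ∧
      (∀ x : 𝒢.L2 μ, (∀ u ∈ U₀, 𝒢.rightRegular μ (ιK (ιf u)) x = x) → (∀ t : T, 𝒢.rightRegular μ (ιK (ιa t)) x = χ t • x) → P x = x) ∧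
      ∀ W : ClosedSubrep (𝒢.rightRegular μ), W.toContRep.IsTopIrreducible → W ≤ residualSubspace 𝒢 μ 𝔓 → ∀ w ∈ W, P w ∈ A := by
  obtain ⟨Aχ, hAχ, hmem⟩ := exists_atom_of_noLineMass Eis U hEXH
    {W : ClosedSubrep (𝒢.rightRegular μ) | W.toContRep.IsTopIrreducible ∧ W ≤ residualSubspace 𝒢 μ 𝔓} (fun W => W.toSubmodule) P
    (fun W hW w hw => hPEis W hW.1 hW.2 w hw) (fun W hW w hw b => hD5 W hW.1 hW.2 w hw b)
  exact ⟨P, Aχ, hAχ, hPfix, fun W hWirr hWle w hw => hmem W ⟨hWirr, hWle⟩ w hw⟩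

end Residual

end Summit.HodgeConjecture.HodgeConjecture.Cruxes.H413.K2E1ResidueAtomsOfNoLineMassU

end
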